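import Literature.AnabelianGeometry.EtaleTheta.Discharge.Sec2CuspOrbitCount
import Literature.AnabelianGeometry.EtaleTheta.Discharge.Sec2AutKHoldsXu

/-!
# [EtTh] Corollary 2.9 (labels of cusps), undotted members `C̲`, `C̲̲`: `#(Aut_K(−)-orbits of cusps) =
# #(ℤ/lℤ)^±` modulo a cusp-stabiliser hypothesis (proof-only companion of `ThetaCoversTempered.lean`)

Mochizuki, *The Étale Theta Function …* [EtTh], Publ. RIMS 45 (2009), §2, Corollary 2.9, PRIMS text
p.43 (printed 269; locators = PDF pages; bib key `MochizukiEtTh2009`): "Suppose that `K` contains a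
primitive `l`-th root of unity. Then for each of … `X̲̲^log; C̲^log; C̲̲^log`, the labels … determine a bijection
of the set `(ℤ/lℤ)^±` with the set of 'Aut_K(−)'-orbits of the cusps" [cite: MochizukiEtTh2009, Cor 2.9 p.43].

Cell abc-iut, layer L2, discharge seat abc-iut-L2-d3 (node EtTh:Cor2.9), companion of seat abc-iut-L2-t2's
`ThetaCoversTempered.lean`, where Cor 2.9 is typed as the CARDINALITY statement `Cor29_card`:
`#(N_{Π^tp_C}(Π^tp_Z)\Π^tp_C/cuspStabC) = (l+1)/2` with `cuspStabC := N_{Π^tp_C}(Π^tp_C ∩ D_x)`.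

FINDING (interface under-determination, reported): `TemperedCoverData` carries NO axiom relating the
tempered group to the cusp `x` (`Π^tp_C ∩ D_x` may even be trivial in a model of the interface, and then
`Cor29_card` is false for `l ≥ 3`). The printed facts needed are (a) that the stabiliser in `Π^tp_X` of the
cusp lies in `Π^tp_{X̲}` ("the restricted map `D_x → Q` is trivial", Def 2.1 p.36, + self-normalisation of cusp
decomposition groups) and (b) that the cusp of `X` is fixed by the inversion of `C = X/{±1}` (an element of
the cusp stabiliser outside `Π^tp_X`). They enter as the explicit hypotheses

  `hC1 : T.cuspStabC ⊓ T.tp T.PiX ≤ T.tp T.PiXu`,   `hC2 : ¬ T.cuspStabC ≤ T.tp T.PiX`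

(`hC1` follows from the self-normalisation of the cusp's decomposition group in `Π^tp_X`:
`cuspStabC_inf_le_of_selfNormalizing`).

RESULTS: a coordinate `F : Π_C → ℤ/lℤ` identifying `Π_{C̲}\Π_C` with `ℤ/lℤ` on which `Π_{X̲}` acts trivially and
the non-trivial coset of `Π_X` acts by reflections (`coord_*` lemmas over `CoverDataAx`); whence, for every
member `Z` with `N_{Π^tp_C}(Π^tp_Z) = Π^tp_{C̲}`, **`#(Aut_K(Z)-orbits of cusps) = (l+1)/2`**
(`natCard_cuspOrbits_of_normalizer_eq`), in particular for `C̲` (unconditionally in `μ_l`) and `C̲̲` (under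
`HasMuL`): `natCard_cuspOrbits_tpPiCu`, `natCard_cuspOrbits_tpPiCuu`. The member `X̲̲` (normaliser `Π_{C̲}`
under the printed definition of `Δ̄_Θ`) is in `Sec2AutKHolds.lean`; the dotted members `Ẋ̲̲, Ċ̲, Ċ̲̲` need the
§1 structure of `Π^tp_Ċ` (Def 1.7), absent from the interface — not treated. No definition, no named fact;
nothing asserts that a `TemperedCoverData` exists; no side is taken on any disputed claim.
-/

namespace Literature.AnabelianGeometry.EtaleTheta

namespace ThetaCovers

universe u

namespace CoverDataAx

variable {l : ℕ} (X : CoverDataAx.{u} l)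

/-! ### The coordinate `Π_{C̲}\Π_C ≅ ℤ/lℤ` -/

section Coord

variable {H' : Subgroup X.PiC} {ι : X.PiC} {φ : X.PiX →* Multiplicative (ZMod l)}
  {F : X.PiC → Multiplicative (ZMod l)}

/-- `ι⁻¹ x ∈ Π_X` for `x ∉ Π_X` (`[Π_C : Π_X] = 2`, `ι̲ ∉ Π_X`). [cite: MochizukiEtTh2009, Def 2.1 p.36] -/
theorem inv_inversion_mul_mem (hι : X.toCoverData.IsInversion H' ι) {x : X.PiC} (hx : x ∉ X.PiX) :
    ι⁻¹ * x ∈ X.PiX :=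
  (Subgroup.mul_mem_iff_of_index_two X.index_PiX).mpr
    (iff_of_false (fun h => hι.not_mem ((Subgroup.inv_mem_iff _).mp h)) hx)

/-- The quotient map `φ : Π_X ↠ Q` kills `Π_{X̲} = H' ∩ Π_X`. [cite: MochizukiEtTh2009, Def 2.1 p.36] -/
theorem coord_phi_eq_one (hφk : ∀ g : X.PiX, φ g = 1 ↔ (g : X.PiC) ∈ H' ⊓ X.PiX) {x : X.PiC}
    (hx : x ∈ H' ⊓ X.PiX) : φ ⟨x, hx.2⟩ = 1 := (hφk _).mpr hx

/-- The inversion acts by `−1` on `Q`: `φ(ι̲ x ι̲⁻¹) = φ(x)⁻¹` ("`ι` acts on `Q` by multiplication by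
`−1`", Rmk 2.1.1). [cite: MochizukiEtTh2009, Rmk 2.1.1 p.36] -/
theorem coord_phi_conj' (hH' : X.toCoverData.IsTypeLTorsPm H') (hι : X.toCoverData.IsInversion H' ι)
    (hφk : ∀ g : X.PiX, φ g = 1 ↔ (g : X.PiC) ∈ H' ⊓ X.PiX) {x : X.PiC} (hx : x ∈ X.PiX)
    (hx' : ι * x * ι⁻¹ ∈ X.PiX) : φ ⟨ι * x * ι⁻¹, hx'⟩ = (φ ⟨x, hx⟩)⁻¹ := by
  rw [eq_inv_iff_mul_eq_one, ← map_mul]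
  exact (hφk _).mpr (X.inversion_conj_mul_mem hH' hι hx)

/-- The inversion acts by `−1` on `Q`: `φ(ι̲⁻¹ x ι̲) = φ(x)⁻¹`. [cite: MochizukiEtTh2009, Rmk 2.1.1 p.36] -/
theorem coord_phi_conj (hH' : X.toCoverData.IsTypeLTorsPm H') (hι : X.toCoverData.IsInversion H' ι)
    (hφk : ∀ g : X.PiX, φ g = 1 ↔ (g : X.PiC) ∈ H' ⊓ X.PiX) {x : X.PiC} (hx : x ∈ X.PiX)
    (hx' : ι⁻¹ * x * ι ∈ X.PiX) : φ ⟨ι⁻¹ * x * ι, hx'⟩ = (φ ⟨x, hx⟩)⁻¹ := by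
  rw [eq_comm, inv_eq_iff_mul_eq_one, ← map_mul]
  refine (hφk _).mpr ?_
  have h := X.inversion_conj_mul_mem hH' hι hx'
  have e : ι * (ι⁻¹ * x * ι) * ι⁻¹ * (ι⁻¹ * x * ι) = x * (ι⁻¹ * x * ι) := by group
  rw [e] at h
  exact h

/-- **Left invariance**: `F(h x) = F(x)` for `h ∈ Π_{C̲} = H'`. [cite: MochizukiEtTh2009, Cor 2.9 p.43] -/
theorem coord_mul_left (hι : X.toCoverData.IsInversion H' ι)
    (hφk : ∀ g : X.PiX, φ g = 1 ↔ (g : X.PiC) ∈ H' ⊓ X.PiX)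
    (hF1 : ∀ (x : X.PiC) (hx : x ∈ X.PiX), F x = φ ⟨x, hx⟩)
    (hF2 : ∀ (x : X.PiC) (hx : ι⁻¹ * x ∈ X.PiX), x ∉ X.PiX → F x = φ ⟨ι⁻¹ * x, hx⟩)
    {h x : X.PiC} (hh : h ∈ H') : F (h * x) = F x := by
  haveI := X.PiX_normal
  by_cases hx : x ∈ X.PiX
  · by_cases hhX : h ∈ X.PiX
    · rw [hF1 _ (Subgroup.mul_mem _ hhX hx), hF1 _ hx]
      have e : (⟨h * x, Subgroup.mul_mem _ hhX hx⟩ : X.PiX) = ⟨h, hhX⟩ * ⟨x, hx⟩ := rfl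
      rw [e, map_mul, X.coord_phi_eq_one hφk ⟨hh, hhX⟩, one_mul]
    · have hhx : h * x ∉ X.PiX := fun h1 => hhX ((Subgroup.mul_mem_cancel_right _ hx).mp h1)
      have h2 : ι⁻¹ * (h * x) ∈ X.PiX := X.inv_inversion_mul_mem hι hhx
      have h3 : ι⁻¹ * h ∈ X.PiX := X.inv_inversion_mul_mem hι hhX
      rw [hF2 _ h2 hhx, hF1 _ hx]
      have e : (⟨ι⁻¹ * (h * x), h2⟩ : X.PiX) = ⟨ι⁻¹ * h, h3⟩ * ⟨x, hx⟩ := Subtype.ext (by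
        change ι⁻¹ * (h * x) = ι⁻¹ * h * x; group)
      rw [e, map_mul, X.coord_phi_eq_one hφk ⟨Subgroup.mul_mem _ (Subgroup.inv_mem _ hι.mem) hh, h3⟩,
        one_mul]
  · have hιx : ι⁻¹ * x ∈ X.PiX := X.inv_inversion_mul_mem hι hx
    by_cases hhX : h ∈ X.PiX
    · have hhx : h * x ∉ X.PiX := fun h1 => hx ((Subgroup.mul_mem_cancel_left _ hhX).mp h1)
      have h2 : ι⁻¹ * (h * x) ∈ X.PiX := X.inv_inversion_mul_mem hι hhx
      have h3 : ι⁻¹ * h * ι ∈ X.PiX := by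
        have := X.PiX_normal.conj_mem _ hhX ι⁻¹
        rwa [inv_inv] at this
      rw [hF2 _ h2 hhx, hF2 _ hιx hx]
      have e : (⟨ι⁻¹ * (h * x), h2⟩ : X.PiX) = ⟨ι⁻¹ * h * ι, h3⟩ * ⟨ι⁻¹ * x, hιx⟩ := Subtype.ext (by
        change ι⁻¹ * (h * x) = ι⁻¹ * h * ι * (ι⁻¹ * x); group)
      have hH3 : ι⁻¹ * h * ι ∈ H' ⊓ X.PiX :=
        ⟨Subgroup.mul_mem _ (Subgroup.mul_mem _ (Subgroup.inv_mem _ hι.mem) hh) hι.mem, h3⟩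
      rw [e, map_mul, X.coord_phi_eq_one hφk hH3, one_mul]
    · have hhx : h * x ∈ X.PiX :=
        (Subgroup.mul_mem_iff_of_index_two X.index_PiX).mpr (iff_of_false hhX hx)
      have h3 : h * ι ∈ X.PiX :=
        (Subgroup.mul_mem_iff_of_index_two X.index_PiX).mpr (iff_of_false hhX hι.not_mem)
      rw [hF1 _ hhx, hF2 _ hιx hx]
      have e : (⟨h * x, hhx⟩ : X.PiX) = ⟨h * ι, h3⟩ * ⟨ι⁻¹ * x, hιx⟩ := Subtype.ext (by
        change h * x = h * ι * (ι⁻¹ * x); group)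
      rw [e, map_mul, X.coord_phi_eq_one hφk ⟨Subgroup.mul_mem _ hh hι.mem, h3⟩, one_mul]

/-- **Injectivity on `Π_{C̲}\Π_C`**: `F(x) = F(y)` implies `y x⁻¹ ∈ Π_{C̲} = H'`.
[cite: MochizukiEtTh2009, Cor 2.9 p.43] -/
theorem coord_eq_imp (hι : X.toCoverData.IsInversion H' ι)
    (hφk : ∀ g : X.PiX, φ g = 1 ↔ (g : X.PiC) ∈ H' ⊓ X.PiX)
    (hF1 : ∀ (x : X.PiC) (hx : x ∈ X.PiX), F x = φ ⟨x, hx⟩)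
    (hF2 : ∀ (x : X.PiC) (hx : ι⁻¹ * x ∈ X.PiX), x ∉ X.PiX → F x = φ ⟨ι⁻¹ * x, hx⟩)
    {x y : X.PiC} (hxy : F x = F y) : y * x⁻¹ ∈ H' := by
  haveI := X.PiX_normal
  -- `φ a = φ b ⇒ b a⁻¹ ∈ H'` for `a, b ∈ Π_X`
  have key : ∀ {a b : X.PiC} (ha : a ∈ X.PiX) (hb : b ∈ X.PiX), φ ⟨a, ha⟩ = φ ⟨b, hb⟩ →
      b * a⁻¹ ∈ H' ⊓ X.PiX := by
    intro a b ha hb hab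
    refine (hφk (⟨b, hb⟩ * ⟨a, ha⟩⁻¹)).mp ?_
    rw [map_mul, map_inv, hab, mul_inv_cancel]
  by_cases hx : x ∈ X.PiX
  · by_cases hy : y ∈ X.PiX
    · rw [hF1 _ hx, hF1 _ hy] at hxy
      exact (key hx hy hxy).1
    · have hιy := X.inv_inversion_mul_mem hι hy
      rw [hF1 _ hx, hF2 _ hιy hy] at hxy
      have h1 := (key hx hιy hxy).1
      have e : y * x⁻¹ = ι * (ι⁻¹ * y * x⁻¹) := by group
      rw [e]
      exact Subgroup.mul_mem _ hι.mem h1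
  · have hιx := X.inv_inversion_mul_mem hι hx
    by_cases hy : y ∈ X.PiX
    · rw [hF2 _ hιx hx, hF1 _ hy] at hxy
      have h1 := (key hιx hy hxy).1
      have e : y * x⁻¹ = (y * (ι⁻¹ * x)⁻¹) * ι⁻¹ := by group
      rw [e]
      exact Subgroup.mul_mem _ h1 (Subgroup.inv_mem _ hι.mem)
    · have hιy := X.inv_inversion_mul_mem hι hy
      rw [hF2 _ hιx hx, hF2 _ hιy hy] at hxy
      have h1 := (key hιx hιy hxy).1
      have e : y * x⁻¹ = ι * (ι⁻¹ * y * (ι⁻¹ * x)⁻¹) * ι⁻¹ := by group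
      rw [e]
      exact Subgroup.mul_mem _ (Subgroup.mul_mem _ hι.mem h1) (Subgroup.inv_mem _ hι.mem)

/-- **Right invariance under `Π_{X̲}`**: `F(x k) = F(x)` for `k ∈ Π_{X̲} = H' ∩ Π_X` (⊇ `D_x`).
[cite: MochizukiEtTh2009, Cor 2.9 p.43] -/
theorem coord_mul_right_mem (hι : X.toCoverData.IsInversion H' ι)
    (hφk : ∀ g : X.PiX, φ g = 1 ↔ (g : X.PiC) ∈ H' ⊓ X.PiX)
    (hF1 : ∀ (x : X.PiC) (hx : x ∈ X.PiX), F x = φ ⟨x, hx⟩)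
    (hF2 : ∀ (x : X.PiC) (hx : ι⁻¹ * x ∈ X.PiX), x ∉ X.PiX → F x = φ ⟨ι⁻¹ * x, hx⟩)
    {x k : X.PiC} (hk : k ∈ H' ⊓ X.PiX) : F (x * k) = F x := by
  by_cases hx : x ∈ X.PiX
  · rw [hF1 _ (Subgroup.mul_mem _ hx hk.2), hF1 _ hx]
    have e : (⟨x * k, Subgroup.mul_mem _ hx hk.2⟩ : X.PiX) = ⟨x, hx⟩ * ⟨k, hk.2⟩ := rfl
    rw [e, map_mul, X.coord_phi_eq_one hφk hk, mul_one]
  · have hιx := X.inv_inversion_mul_mem hι hx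
    have hxk : x * k ∉ X.PiX := fun h1 => hx ((Subgroup.mul_mem_cancel_right _ hk.2).mp h1)
    have hιxk := X.inv_inversion_mul_mem hι hxk
    rw [hF2 _ hιxk hxk, hF2 _ hιx hx]
    have e : (⟨ι⁻¹ * (x * k), hιxk⟩ : X.PiX) = ⟨ι⁻¹ * x, hιx⟩ * ⟨k, hk.2⟩ := Subtype.ext (by
      change ι⁻¹ * (x * k) = ι⁻¹ * x * k; group)
    rw [e, map_mul, X.coord_phi_eq_one hφk hk, mul_one]

/-- **The reflections**: `F(x y) = F(y) · F(x)⁻¹` for `y ∉ Π_X` (the inversion negates the coordinate).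
[cite: MochizukiEtTh2009, Cor 2.9 p.43] -/
theorem coord_mul_right_not_mem (hH' : X.toCoverData.IsTypeLTorsPm H')
    (hι : X.toCoverData.IsInversion H' ι)
    (hφk : ∀ g : X.PiX, φ g = 1 ↔ (g : X.PiC) ∈ H' ⊓ X.PiX)
    (hF1 : ∀ (x : X.PiC) (hx : x ∈ X.PiX), F x = φ ⟨x, hx⟩)
    (hF2 : ∀ (x : X.PiC) (hx : ι⁻¹ * x ∈ X.PiX), x ∉ X.PiX → F x = φ ⟨ι⁻¹ * x, hx⟩)
    {x y : X.PiC} (hy : y ∉ X.PiX) : F (x * y) = F y * (F x)⁻¹ := by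
  haveI := X.PiX_normal
  have hιy := X.inv_inversion_mul_mem hι hy
  by_cases hx : x ∈ X.PiX
  · have hxy : x * y ∉ X.PiX := fun h1 => hy ((Subgroup.mul_mem_cancel_left _ hx).mp h1)
    have hιxy := X.inv_inversion_mul_mem hι hxy
    have h3 : ι⁻¹ * x * ι ∈ X.PiX := by
      have := X.PiX_normal.conj_mem _ hx ι⁻¹
      rwa [inv_inv] at this
    rw [hF2 _ hιxy hxy, hF2 _ hιy hy, hF1 _ hx]
    have e : (⟨ι⁻¹ * (x * y), hιxy⟩ : X.PiX) = ⟨ι⁻¹ * x * ι, h3⟩ * ⟨ι⁻¹ * y, hιy⟩ := Subtype.ext (by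
      change ι⁻¹ * (x * y) = ι⁻¹ * x * ι * (ι⁻¹ * y); group)
    rw [e, map_mul, X.coord_phi_conj hH' hι hφk hx h3, mul_comm]
  · have hιx := X.inv_inversion_mul_mem hι hx
    have hxy : x * y ∈ X.PiX :=
      (Subgroup.mul_mem_iff_of_index_two X.index_PiX).mpr (iff_of_false hx hy)
    have hιι : ι * ι ∈ H' ⊓ X.PiX :=
      ⟨Subgroup.mul_mem _ hι.mem hι.mem,
        (Subgroup.mul_mem_iff_of_index_two X.index_PiX).mpr (iff_of_false hι.not_mem hι.not_mem)⟩
    have h3 : ι * (ι⁻¹ * x) * ι⁻¹ ∈ X.PiX := X.PiX_normal.conj_mem _ hιx ι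
    rw [hF1 _ hxy, hF2 _ hιy hy, hF2 _ hιx hx]
    -- `x y = (ι (ι⁻¹ x) ι⁻¹) · ι² · (ι⁻¹ y)`
    have e : (⟨x * y, hxy⟩ : X.PiX) = (⟨ι * (ι⁻¹ * x) * ι⁻¹, h3⟩ * ⟨ι * ι, hιι.2⟩) * ⟨ι⁻¹ * y, hιy⟩ :=
      Subtype.ext (by change x * y = ι * (ι⁻¹ * x) * ι⁻¹ * (ι * ι) * (ι⁻¹ * y); group)
    rw [e, map_mul, map_mul, X.coord_phi_conj' hH' hι hφk hιx h3, X.coord_phi_eq_one hφk hιι, mul_one,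
      mul_comm]

end Coord

end CoverDataAx

/-! ### Corollary 2.9 for members with normaliser `Π^tp_{C̲}` -/

namespace TemperedCoverData

variable {l : ℕ} (T : TemperedCoverData.{u} l)

/-- The cusp hypothesis `hC1` follows from the SELF-NORMALISATION of the tempered decomposition group of
the cusp inside `Π^tp_X` ("commensurable terminality" of cusp decomposition groups, an anabelian input of
[SemiAnbd] §6 type) together with `D_x ⊆ Π_{X̲}` ("the restricted map `D_x → Q` is trivial", Def 2.1).
[cite: MochizukiEtTh2009, Def 2.1 p.36] -/
theorem cuspStabC_inf_le_of_selfNormalizing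
    (hCT : T.cuspStabC ⊓ T.tp T.PiX ≤ T.tp T.Dx) : T.cuspStabC ⊓ T.tp T.PiX ≤ T.tp T.PiXu := by
  obtain ⟨H', E, S, ι, hH', hι, -, hE, hS, hdef⟩ := T.isTypeLTorsThetaPm.out
  rw [T.PiXu_eq_inf hH' hι hE hS hdef]
  exact hCT.trans (Subgroup.comap_mono hH'.inf_isTypeLTors.Dx_le)

/-- **Cor 2.9, count**: for a member `Z` of the tower with `N_{Π^tp_C}(Π^tp_Z) = Π^tp_{C̲}`, the
`Aut_K(Z)`-orbits of cusps number `#(ℤ/lℤ)^± = (l+1)/2` — modulo the cusp-stabiliser hypotheses `hC1`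
(the stabiliser in `Π^tp_X` of the cusp lies in `Π^tp_{X̲}`) and `hC2` (the inversion of `C` fixes the
cusp), which the interface does not carry. [cite: MochizukiEtTh2009, Cor 2.9 p.43] -/
theorem natCard_cuspOrbits_of_normalizer_eq (hC1 : T.cuspStabC ⊓ T.tp T.PiX ≤ T.tp T.PiXu)
    (hC2 : ¬ T.cuspStabC ≤ T.tp T.PiX) {S' : Subgroup T.Gtp}
    (hN : Subgroup.normalizer ((S' : Subgroup T.Gtp) : Set T.Gtp) = T.tp T.PiCu) :
    Nat.card (T.cuspOrbits S') = (l + 1) / 2 := by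
  classical
  obtain ⟨H', E, S, ι, hH', hι, -, hE, hS, hdef⟩ := T.isTypeLTorsThetaPm.out
  have hT := hH'.inf_isTypeLTors
  obtain ⟨φ, hφs, hφk⟩ := hT.quot
  have hCu : T.PiCu = H' := T.PiCu_eq hH' hι hE hS hdef
  have hXu : T.PiXu = H' ⊓ T.PiX := T.PiXu_eq_inf hH' hι hE hS hdef
  -- the coordinate
  let F : T.PiC → Multiplicative (ZMod l) := fun x =>
    if hx : x ∈ T.PiX then φ ⟨x, hx⟩ else φ ⟨ι⁻¹ * x, T.toCoverDataAx.inv_inversion_mul_mem hι hx⟩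
  have hF1 : ∀ (x : T.PiC) (hx : x ∈ T.PiX), F x = φ ⟨x, hx⟩ := fun x hx => by
    simp only [F, dif_pos hx]
  have hF2 : ∀ (x : T.PiC) (hx : ι⁻¹ * x ∈ T.PiX), x ∉ T.PiX → F x = φ ⟨ι⁻¹ * x, hx⟩ :=
    fun x hx hx' => by simp only [F, dif_neg hx']
  let f : T.Gtp → ZMod l := fun a => Multiplicative.toAdd (F (T.toHat a))
  have hf : ∀ a, f a = Multiplicative.toAdd (F (T.toHat a)) := fun a => rfl
  -- a reflection `k₀`
  obtain ⟨k₀, hk₀D, hk₀X⟩ := SetLike.not_le_iff_exists.mp hC2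
  have hk₀X' : T.toHat k₀ ∉ T.PiX := hk₀X
  have hDX : ∀ k ∈ T.cuspStabC, k ∈ T.tp T.PiX → T.toHat k ∈ H' ⊓ T.PiX := fun k hk hkX => by
    have : k ∈ T.tp T.PiXu := hC1 ⟨hk, hkX⟩
    rw [hXu] at this
    exact this
  unfold cuspOrbits
  rw [hN, hCu]
  refine natCard_doubleCoset_quotient_of_reflection T.l_odd (T.tp H') T.cuspStabC f ?_ ?_
    (Multiplicative.toAdd (F (T.toHat k₀))) ?_ ⟨k₀, hk₀D, fun a => ?_⟩
  · -- surjective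
    intro v
    obtain ⟨x, hx⟩ := hφs (Multiplicative.ofAdd v)
    have hopen : IsOpen ((H' ⊓ T.PiX : Subgroup T.PiC) : Set T.PiC) :=
      hXu ▸ Subgroup.isOpen_mono (le_sup_left : T.PiXuu ≤ T.PiXu)
        (T.isOpen_PiCuu'.inter T.isOpen_PiX : IsOpen (T.PiXuu : Set T.PiC))
    obtain ⟨m, hm⟩ := T.exists_toHat_mem_coset hopen (x : T.PiC)
    refine ⟨m, ?_⟩
    have e : T.toHat m = (x : T.PiC) * ((x : T.PiC)⁻¹ * T.toHat m) := by group
    rw [hf, e, T.toCoverDataAx.coord_mul_right_mem hι hφk hF1 hF2 hm, hF1 _ x.2]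
    simp [hx]
  · -- injectivity modulo `tp H'`
    intro a b
    constructor
    · intro hab
      have h1 : F (T.toHat a) = F (T.toHat b) := Multiplicative.toAdd.injective hab
      have h2 := T.toCoverDataAx.coord_eq_imp hι hφk hF1 hF2 h1
      refine ⟨b * a⁻¹, ?_, by group⟩
      change T.toHat (b * a⁻¹) ∈ H'
      rwa [map_mul, map_inv]
    · rintro ⟨n, hn, rfl⟩
      rw [hf, hf, map_mul]
      exact congrArg _ (T.toCoverDataAx.coord_mul_left hι hφk hF1 hF2 hn).symm
  · -- the action of the cusp stabiliser
    intro k hk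
    by_cases hkX : k ∈ T.tp T.PiX
    · left
      intro a
      rw [hf, hf, map_mul, T.toCoverDataAx.coord_mul_right_mem hι hφk hF1 hF2 (hDX k hk hkX)]
    · right
      intro a
      have hkX' : T.toHat k ∉ T.PiX := hkX
      have hkk : T.toHat (k₀⁻¹ * k) ∈ H' ⊓ T.PiX := by
        refine hDX _ (Subgroup.mul_mem _ (Subgroup.inv_mem _ hk₀D) hk) ?_
        change T.toHat (k₀⁻¹ * k) ∈ T.PiX
        rw [map_mul, map_inv]
        exact (Subgroup.mul_mem_iff_of_index_two T.index_PiX).mpr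
          (iff_of_false (fun h => hk₀X' ((Subgroup.inv_mem_iff _).mp h)) hkX')
      have hFk : F (T.toHat k) = F (T.toHat k₀) := by
        have e : T.toHat k = T.toHat k₀ * T.toHat (k₀⁻¹ * k) := by rw [map_mul, map_inv]; group
        rw [e, T.toCoverDataAx.coord_mul_right_mem hι hφk hF1 hF2 hkk]
      rw [hf, hf, map_mul, T.toCoverDataAx.coord_mul_right_not_mem hH' hι hφk hF1 hF2 hkX', hFk,
        toAdd_mul, toAdd_inv, sub_eq_add_neg]
  · rw [hf, hf, map_mul, T.toCoverDataAx.coord_mul_right_not_mem hH' hι hφk hF1 hF2 hk₀X',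
      toAdd_mul, toAdd_inv, sub_eq_add_neg]

/-- **Cor 2.9 for `C̲`**: `#(Aut_K(C̲)-orbits of cusps) = (l+1)/2`, modulo the cusp hypotheses `hC1`, `hC2`
(`N(Π^tp_{C̲}) = Π^tp_{C̲}` is unconditional, Rmk 2.1.1). [cite: MochizukiEtTh2009, Cor 2.9 p.43] -/
theorem natCard_cuspOrbits_tpPiCu (hC1 : T.cuspStabC ⊓ T.tp T.PiX ≤ T.tp T.PiXu)
    (hC2 : ¬ T.cuspStabC ≤ T.tp T.PiX) : Nat.card (T.cuspOrbits (T.tp T.PiCu)) = (l + 1) / 2 :=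
  T.natCard_cuspOrbits_of_normalizer_eq hC1 hC2
    (by rw [T.normalizer_tp_eq_of_isOpen T.isOpen_PiCu, T.normalizer_PiCu_eq])

/-- **Cor 2.9 for `C̲̲`** (under `μ_l ⊆ K`): `#(Aut_K(C̲̲)-orbits of cusps) = (l+1)/2`, modulo the cusp
hypotheses `hC1`, `hC2` (`N(Π^tp_{C̲̲}) = Π^tp_{C̲}`). [cite: MochizukiEtTh2009, Cor 2.9 p.43] -/
theorem natCard_cuspOrbits_tpPiCuu (hmu : T.HasMuL) (hC1 : T.cuspStabC ⊓ T.tp T.PiX ≤ T.tp T.PiXu)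
    (hC2 : ¬ T.cuspStabC ≤ T.tp T.PiX) : Nat.card (T.cuspOrbits (T.tp T.PiCuu)) = (l + 1) / 2 :=
  T.natCard_cuspOrbits_of_normalizer_eq hC1 hC2 (T.normalizer_tpPiCuu_eq hmu)

end TemperedCoverData

end ThetaCovers

end Literature.AnabelianGeometry.EtaleTheta
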